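import Literature.AlgebraicGeometry.HodgeTheory.AlgebraicityLocusDichotomy
import HarnessLib

/-!
# The generic dichotomy for supported classes from local triviality of the COMPLEMENT family

Topic `Literature/AlgebraicGeometry/HodgeTheory` (family `hodge`), companion of
`AlgebraicityLocusDichotomy` in the proof programme of the named fact
`charlesSchnell_algebraicityLocus_iUnion_closed` (Charles–Schnell 2014, proof of Prop. 11.3.11;
Voisin, *Hodge Theory II*, §3.3.1, §7.3.2). The vanishing condition "`A|_{𝒳_{g(y)}}` dies off
the slice `𝒵_y`" is the death of `A` under `(𝒳_{g(y)} ∖ 𝒵_y)(ℂ) → 𝒳(ℂ)`, so its local constancy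
only needs a trivialisation of the COMPLEMENT family `{(y, x) | f x = g y, (x, y) ∉ 𝒵}` over
path connected pieces of the parameter space — not of the pair (`𝒳 ×_S H`, `𝒵`) as in
`dichotomy_of_pairTrivialisation`. This is the form delivered by Ehresmann's theorem relative to
a normal crossings compactification of the complement (Voisin I §9.1.1; Dimca 1992 Ch. 1 (3.1))
after a log resolution, over the generic part of an irreducible parameter variety.

* `map_subtypeVal_eq_zero_iff_of_complTrivialisation` — pure topology: for `p : E → B`,
  `h : Y → B`, `C ⊆ Y × E`, `A ∈ Hᵏ(E; F)` and a homeomorphism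
  `V × K ≃ {(v, e) | p e = h v, (v, e) ∉ C}` over a path connected `V ⊆ Y`, the death of `A` on
  `p⁻¹(h y) ∖ C_y` is independent of `y ∈ V` (homotopy invariance along paths in `V`);
* `dichotomy_of_complTrivialisation` — on the real carriers, exactly as
  `dichotomy_of_pairTrivialisation` but with complement trivialisations as input (`htriv`).

Everything is proved; no named facts.

## References

* [CharlesSchnell2014Notes] F. Charles, C. Schnell, Notes on absolute Hodge classes (2014),
  Prop. 11.3.11 (proof).
* [VoisinHodgeI2002] C. Voisin, Hodge Theory and Complex Algebraic Geometry I (2002), §9.1.1.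
* [SGA1] A. Grothendieck, M. Raynaud, SGA 1, Exp. XII Prop. 2.4.
* [HatcherAT2002] A. Hatcher, Algebraic Topology (2002), Thm. 2.10, §3.1.
-/

noncomputable section

open CategoryTheory AlgebraicGeometry Limits Set MonoidalCategory CartesianMonoidalCategory
open _root_.Topology TopologicalSpace Filter unitInterval
open Literature.AlgebraicTopology.SingularHomology
open Literature.AlgebraicGeometry.Motives

universe u v

namespace Literature.AlgebraicGeometry.HodgeTheory

section HodgeTheory

/-! ### Pure topology: vanishing off the slices is constant under a trivialisation of the complement -/

section Topology

variable (F : Type v) [Field F]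

/-- **Vanishing off the slices is constant along paths, given a trivialisation of the
complement family.** Let `p : E → B`, `h : Y → B`, `C ⊆ Y × E`, `A ∈ Hᵏ(E; F)`, and let `V ⊆ Y`
be path connected with a homeomorphism `φ : V × K ≃ {(v, e) | p e = h v, (v, e) ∉ C}` over `V`.
Then for `y, y' ∈ V`, `A` dies on `p⁻¹(h y) ∖ C_y` iff it dies on `p⁻¹(h y') ∖ C_{y'}`: both are
the death of `A` under `K → E`, `e₀ ↦ φ(v, e₀)`, for `v = y, y'`, homotopic maps.
[cite: HatcherAT2002, Thm. 2.10 and §3.1] -/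
theorem map_subtypeVal_eq_zero_iff_of_complTrivialisation {E B Y : Type u} [TopologicalSpace E]
    [TopologicalSpace B] [TopologicalSpace Y] (p : E → B) (h : Y → B) (C : Set (Y × E)) {k : ℕ}
    (A : singularCohomology F F E k) {V : Set Y} (hV : IsPathConnected V) {K : Type u}
    [TopologicalSpace K]
    (φ : ↥V × K ≃ₜ {q : ↥V × E // p q.2 = h q.1 ∧ ((q.1 : Y), q.2) ∉ C})
    (hφ₁ : ∀ x, (φ x).1.1 = x.1) {y y' : Y} (hy : y ∈ V) (hy' : y' ∈ V) :
    singularCohomology.map F F (⟨Subtype.val, continuous_subtype_val⟩ :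
        C({e : E // p e = h y ∧ (y, e) ∉ C}, E)) k A = 0 ↔
      singularCohomology.map F F (⟨Subtype.val, continuous_subtype_val⟩ :
        C({e : E // p e = h y' ∧ (y', e) ∉ C}, E)) k A = 0 := by
  have hcont : Continuous fun x : ↥V × K => ((φ x).1.2 : E) :=
    continuous_snd.comp (continuous_subtype_val.comp φ.continuous)
  let m : ↥V → C(K, E) := fun v =>
    ⟨fun e₀ => (φ (v, e₀)).1.2, hcont.comp (continuous_const.prodMk continuous_id)⟩
  -- key: for `v ∈ V`, death off the slice at `v` iff death under `m v`
  have hkey : ∀ v : ↥V, singularCohomology.map F F (⟨Subtype.val, continuous_subtype_val⟩ :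
      C({e : E // p e = h v ∧ ((v : Y), e) ∉ C}, E)) k A = 0 ↔
        singularCohomology.map F F (m v) k A = 0 := by
    intro v
    have hn : ∀ e₀ : K, p (φ (v, e₀)).1.2 = h v ∧ ((v : Y), ((φ (v, e₀)).1.2 : E)) ∉ C := by
      intro e₀
      have h1 : (φ (v, e₀)).1.1 = v := hφ₁ (v, e₀)
      have h2 := (φ (v, e₀)).2
      rw [h1] at h2
      exact h2
    let n : C(K, {e : E // p e = h v ∧ ((v : Y), e) ∉ C}) :=
      ⟨fun e₀ => ⟨(φ (v, e₀)).1.2, hn e₀⟩, (hcont.comp (continuous_const.prodMk continuous_id)).subtype_mk _⟩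
    let i : C({e : E // p e = h v ∧ ((v : Y), e) ∉ C}, K) :=
      ⟨fun w => (φ.symm ⟨(v, w.1), w.2⟩).2,
        continuous_snd.comp (φ.symm.continuous.comp
          ((continuous_const.prodMk continuous_subtype_val).subtype_mk _))⟩
    have hfac₁ : m v = (⟨Subtype.val, continuous_subtype_val⟩ :
        C({e : E // p e = h v ∧ ((v : Y), e) ∉ C}, E)).comp n := by
      ext e₀
      rfl
    have hfac₂ : (⟨Subtype.val, continuous_subtype_val⟩ :
        C({e : E // p e = h v ∧ ((v : Y), e) ∉ C}, E)) = (m v).comp i := by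
      ext w
      have h1 : (φ.symm ⟨(v, w.1), w.2⟩).1 = v := by
        have h := hφ₁ (φ.symm ⟨(v, w.1), w.2⟩)
        rw [Homeomorph.apply_symm_apply] at h
        exact h.symm
      change w.1 = ((φ (v, (φ.symm ⟨(v, w.1), w.2⟩).2)).1.2 : E)
      have hq : (v, (φ.symm ⟨(v, w.1), w.2⟩).2) = φ.symm ⟨(v, w.1), w.2⟩ := Prod.ext h1.symm rfl
      rw [hq, Homeomorph.apply_symm_apply]
    constructor
    · intro h0
      rw [hfac₁, singularCohomology.map_comp, ModuleCat.comp_apply, h0, map_zero]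
    · intro h0
      rw [hfac₂, singularCohomology.map_comp, ModuleCat.comp_apply, h0, map_zero]
  -- the motions at `y` and `y'` are homotopic along a path in `V`
  haveI : PathConnectedSpace ↥V := isPathConnected_iff_pathConnectedSpace.1 hV
  let γ : Path (⟨y, hy⟩ : ↥V) ⟨y', hy'⟩ := PathConnectedSpace.somePath _ _
  have hhom : (m ⟨y, hy⟩).Homotopic (m ⟨y', hy'⟩) := by
    refine ⟨{ toFun := fun x => (φ (γ x.1, x.2)).1.2
              continuous_toFun := hcont.comp ((γ.continuous.comp continuous_fst).prodMk
                continuous_snd)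
              map_zero_left := fun e₀ => by simp [m, γ.source]
              map_one_left := fun e₀ => by simp [m, γ.target] }⟩
  rw [hkey ⟨y, hy⟩, hkey ⟨y', hy'⟩, singularCohomology.map_eq_of_homotopic' F F hhom k]

end Topology

/-! ### The generic dichotomy from trivialisations of the complement family -/

section Schemes

variable {𝒳 S H : Motives.SchemeOver ℂ} (f : 𝒳 ⟶ S)

/-- **The generic dichotomy from local triviality of the complement family.** As
`dichotomy_of_pairTrivialisation` (`f : 𝒳 ⟶ S` proper, `𝒳` separated, `g : H ⟶ S` locally of
finite type, `𝒵 ⊆ 𝒳 × H`, `A ∈ Hᵏ(𝒳(ℂ); ℂ)`, `Y ⊆ H` closed irreducible, `O` open meeting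
`Y`), but the topological input `htriv` is now: every complex point `y₀` over `Y ∩ O` has a path
connected neighbourhood `V` in the complex points over `Y ∩ O` with a homeomorphism
`V × K ≃ {(v, x) ∈ V × 𝒳(ℂ) | f x = g v, (x, v) ∉ 𝒵}` over `V`. Then `A|_{𝒳_{g(y)}}` dies off
the slice `𝒵_y` at every complex point over `Y ∩ O`, or at none
(`map_subtypeVal_eq_zero_iff_of_complTrivialisation`; connectedness of `(Y ∩ O)(ℂ)`,
SGA1 XII 2.4). [cite: CharlesSchnell2014Notes, Prop. 11.3.11 (proof)]
[cite: SGA1, Exp. XII Prop. 2.4] [cite: VoisinHodgeI2002, §9.1.1] -/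
theorem dichotomy_of_complTrivialisation [IsProper f.left] [IsSeparated 𝒳.hom]
    [LocallyOfFiniteType H.hom] (g : H ⟶ S) (𝒵 : Set (𝒳 ⊗ H).left) (k : ℕ)
    (A : complexBetti 𝒳 k) {Y : Set H.left} (hYc : IsClosed Y) (hY : IsIrreducible Y)
    (O : H.left.Opens) (hYO : (Y ∩ (O : Set H.left)).Nonempty)
    (htriv : ∀ y₀ : Motives.ComplexPoints H, y₀.pt ∈ Y ∧ y₀.pt ∈ (O : Set H.left) →
      ∃ V : Set (Motives.ComplexPoints H),
        V ⊆ {y | y.pt ∈ Y ∧ y.pt ∈ (O : Set H.left)} ∧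
        V ∈ 𝓝[{y | y.pt ∈ Y ∧ y.pt ∈ (O : Set H.left)}] y₀ ∧ IsPathConnected V ∧
        ∃ (K : Type) (_ : TopologicalSpace K)
          (φ : ↥V × K ≃ₜ {q : ↥V × Motives.ComplexPoints 𝒳 //
            AlgPoints.map f q.2 = AlgPoints.map g q.1.1 ∧
              (AlgPoints.prodEquiv.symm (q.2, (q.1.1 : Motives.ComplexPoints H)) :
                Motives.ComplexPoints (𝒳 ⊗ H)).pt ∉ 𝒵}),
          ∀ x, (φ x).1.1 = x.1) :
    (∀ y : Motives.ComplexPoints H, y.pt ∈ Y ∧ y.pt ∈ (O : Set H.left) →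
      complexBetti.map (Motives.fiberι f (AlgPoints.map g y)) k A ∈
        LinearMap.ker (complexBetti.restrictCompl (Motives.fiberOver f (AlgPoints.map g y))
          ((lift (Motives.fiberι f (AlgPoints.map g y))
            (Motives.fiberOverToSpec f (AlgPoints.map g y) ≫ y)).left.base ⁻¹' 𝒵) k).hom) ∨
    (∀ y : Motives.ComplexPoints H, y.pt ∈ Y ∧ y.pt ∈ (O : Set H.left) →
      complexBetti.map (Motives.fiberι f (AlgPoints.map g y)) k A ∉
        LinearMap.ker (complexBetti.restrictCompl (Motives.fiberOver f (AlgPoints.map g y))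
          ((lift (Motives.fiberι f (AlgPoints.map g y))
            (Motives.fiberOverToSpec f (AlgPoints.map g y) ≫ y)).left.base ⁻¹' 𝒵) k).hom) := by
  -- the good set, translated to vanishing off the slices of `C = {(y, Q) | (Q, y) ∈ 𝒵(ℂ)}`
  let C : Set (Motives.ComplexPoints H × Motives.ComplexPoints 𝒳) :=
    {x | (AlgPoints.prodEquiv.symm (x.2, x.1) : Motives.ComplexPoints (𝒳 ⊗ H)).pt ∈ 𝒵}
  let O' : Set (Motives.ComplexPoints H) := {y | y.pt ∈ Y ∧ y.pt ∈ (O : Set H.left)}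
  have hT : ∀ y : Motives.ComplexPoints H,
      complexBetti.map (Motives.fiberι f (AlgPoints.map g y)) k A ∈
        LinearMap.ker (complexBetti.restrictCompl (Motives.fiberOver f (AlgPoints.map g y))
          ((lift (Motives.fiberι f (AlgPoints.map g y))
            (Motives.fiberOverToSpec f (AlgPoints.map g y) ≫ y)).left.base ⁻¹' 𝒵) k).hom ↔
      singularCohomology.map ℂ ℂ (⟨Subtype.val, continuous_subtype_val⟩ :
        C({e : Motives.ComplexPoints 𝒳 // AlgPoints.map f e = AlgPoints.map g y ∧ (y, e) ∉ C},
          Motives.ComplexPoints 𝒳)) k A = 0 := fun y =>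
    map_fiberι_mem_ker_restrictCompl_iff f (AlgPoints.map g) C
      (fun y => (lift (Motives.fiberι f (AlgPoints.map g y))
        (Motives.fiberOverToSpec f (AlgPoints.map g y) ≫ y)).left.base ⁻¹' 𝒵)
      (fun y P => pt_mem_preimage_lift_iff f g 𝒵 y P) k A y
  -- `O'` is connected (SGA1 XII 2.4 for the irreducible `Y ∩ O`)
  have hconn : IsConnected O' :=
    Motives.ComplexPoints.isConnected_setOf_pt_mem_inter_of_isIrreducible H hYc hY O hYO
  haveI : PreconnectedSpace ↥O' := Subtype.preconnectedSpace hconn.isPreconnected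
  -- the vanishing condition is locally constant on `O'`
  let T : ↥O' → Prop := fun y =>
    singularCohomology.map ℂ ℂ (⟨Subtype.val, continuous_subtype_val⟩ :
      C({e : Motives.ComplexPoints 𝒳 //
          AlgPoints.map f e = AlgPoints.map g y.1 ∧ ((y.1 : Motives.ComplexPoints H), e) ∉ C},
        Motives.ComplexPoints 𝒳)) k A = 0
  have hlc : IsLocallyConstant T := by
    rw [IsLocallyConstant.iff_eventually_eq]
    intro y₀
    obtain ⟨V, hVsub, hVn, hVpc, K, _, φ, hφ₁⟩ := htriv y₀.1 y₀.2
    have hy₀V : (y₀ : Motives.ComplexPoints H) ∈ V := mem_of_mem_nhdsWithin y₀.2 hVn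
    have hVn' : Subtype.val ⁻¹' V ∈ 𝓝 y₀ := preimage_coe_mem_nhds_subtype.2 hVn
    filter_upwards [hVn'] with y hy
    exact propext (map_subtypeVal_eq_zero_iff_of_complTrivialisation ℂ (AlgPoints.map f)
      (AlgPoints.map g) C A hVpc φ hφ₁ hy hy₀V)
  -- hence constant
  by_cases hex : ∃ y₁ : ↥O', T y₁
  · obtain ⟨y₁, hy₁⟩ := hex
    refine Or.inl fun y hy => (hT y).2 ?_
    have h : T ⟨y, hy⟩ = T y₁ := hlc.apply_eq_of_preconnectedSpace ⟨y, hy⟩ y₁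
    exact Eq.mp h.symm hy₁
  · push Not at hex
    exact Or.inr fun y hy hgood => hex ⟨y, hy⟩ ((hT y).1 hgood)

end Schemes

end HodgeTheory

end Literature.AlgebraicGeometry.HodgeTheory

end
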